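import Literature.NumberTheory.Rogawski1990.ArchOrbFamGExtRealWallInst      -- ★ `continuous_boostEig_apply`; brings ★ atlas (`boostEig`, `archPiEquivCM`, `torusU`, `unipotentU`)
import Literature.NumberTheory.Automorphic.ArchU21SplitOrbitNormalised       -- ★ `exists_torusU_boostEig_family` (the `τ`, `hτcoe`, `hτmul` binders), `boostEig_ne_zero`
import HarnessLib

/-!
# (B3-JUNCTION) J2-b′ — two compact-support legs of the unfolded model: the `K × N` reading at a split place, and the `w₀`-projection of `tsupport a′`
# (Rogawski 1990 §4.9, §8.2; Harish-Chandra–van Dijk 1970 I §3 Lemma 22; Deitmar–Echterhoff 2014 Lemma 9.3.3)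

Topic `NumberTheory/Rogawski1990`; namespaces `Literature.NumberTheory.Automorphic.UnitaryGroup` (§1–§2) and `Literature.NumberTheory.Rogawski1990` (§3).  THEOREMS ONLY
(no `def`, no instance, no notation, no axiom, no named fact, no `sorry`); kernel lane `--kind proof --supports stmt-HodgeConjecture-24833`.  Cell `pub/hodgecm-mathlib`,
crux H413 (`stmt-HodgeConjecture-24833`), F0∕P3c line LH3 (closer stub `stub_N9`), organ O-L1d (B3-JUNCTION) J2 «central jet bounds», piece (J2-b) «joint smoothness + uniform
support of the partial unfolded model» (holder and binder of record A-p12 (g28)); M-legs (J2-b′) (i)+(ii) dealt to LH1-p03 (g6) by LH3-plan (g4) 2026-09-02T11:36:07Z.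

THE MATHEMATICS.  In the unfolded model ★ (A5a) `orbFamG_eq_unfoldedModel_of_regG` the test function `a′ ∈ C_c(G′_∞)` is evaluated at `e⁻¹(w ↦ …)` whose split-place
components are `φ_w⁻¹(k · τ(0,φ,θ) τ(x∕2,0,0) · n · τ(x∕2,0,0) · k⁻¹)` (`k ∈ K` compact, `n ∈ N` unipotent, `τ` the boost torus family) and whose `w₀`-component is free.
Hörmander's differentiation under the integral needs the integration variables to range in ONE compact set, locally uniformly in the parameters; two elementary legs:
* §1 **`exists_isCompact_of_conj_mul_mem`** (any topological group): if `k · (a(c) · n · b(c)) · k⁻¹ ∈ B` with `k ∈ K`, `c ∈ K_c` (`K`, `K_c`, `B` compact, `a`, `b` continuous),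
  then `n = a(c)⁻¹ · k⁻¹ (k a(c) n b(c) k⁻¹) k · b(c)⁻¹` lies in ONE compact set;
* §2 the `U(J₃)(ℂ)` instance **`exists_isCompact_unipotentU_of_conj_reading_mem`**: the boost family `τ` is continuous (`continuous_torusFamily_of_coe_eq_diagonal_boostEig`, from
  `hτcoe` + `hτmul`), so for `c′` in a compact box and `k` in the compact `K` the unipotent variable `n` with `k τ(0,c′₁,c′₂) τ(c′₀∕2,0,0) n τ(c′₀∕2,0,0) k⁻¹ ∈ B` lies in ONE
  compact subset of the CLOSED subgroup `N`;
* §3 **`exists_isCompact_proj_tsupport`**: the `w₀`-projection `C_g := pr_{w₀}(e(tsupport a′))` is compact and `a′` vanishes at every `g` whose `w₀`-component is off `C_g`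
  (group form and `Function.update` form).
HONEST LABEL: HC_CM is proved only modulo the 7 printed citations (2 remaining: hLiu418 = `stmt-HodgeConjecture-24832`, h413 = `stmt-HodgeConjecture-24833`) until rung 0
closes; count-neutral letter-L1 plumbing.

## References
* [Rogawski1990] J. D. Rogawski, *Automorphic Representations of Unitary Groups in Three Variables*, Ann. of Math. Stud. 123 (1990), §4.9 pp. 54–55, §8.2 pp. 114, 122.
* [HarishChandra1970] Harish-Chandra (notes by G. van Dijk), *Harmonic Analysis on Reductive p-adic Groups*, LNM 162 (1970), Part I §3 Lemma 22.
* [DeitmarEchterhoff2014] A. Deitmar, S. Echterhoff, *Principles of Harmonic Analysis*, 2nd ed. (2014), Lemma 9.3.3.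
-/

set_option autoImplicit false

noncomputable section

open MeasureTheory NumberField NumberField.InfinitePlace Matrix Complex Set Filter Topology
open scoped MatrixGroups Matrix
open Literature.NumberTheory.Rogawski1990

namespace Literature.NumberTheory.Automorphic.UnitaryGroup

/-! ## §1 Solving for the middle factor inside compacts (any topological group) -/

section Generic

variable {G : Type*} [Group G] [TopologicalSpace G] [IsTopologicalGroup G] {P : Type*} [TopologicalSpace P]

/-- **THE MIDDLE FACTOR OF A CONJUGATED PRODUCT LANDING IN A COMPACT LIES IN A COMPACT** (Harish-Chandra's compactness bookkeeping): `a`, `b : P → G` continuous, `K_c ⊆ P`,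
`K`, `B ⊆ G` compact; then ONE compact `C_N ⊆ G` contains every `n` with `k · (a(c) · n · b(c)) · k⁻¹ ∈ B` for some `c ∈ K_c`, `k ∈ K` — namely the image of `K_c × K × B`
under `(c, k, x) ↦ a(c)⁻¹ · (k⁻¹ x k) · b(c)⁻¹`. [cite: HarishChandra1970, Part I §3 Lemma 22] [cite: DeitmarEchterhoff2014, Lemma 9.3.3] -/
theorem exists_isCompact_of_conj_mul_mem {a b : P → G} (ha : Continuous a) (hb : Continuous b)
    {Kc : Set P} (hKc : IsCompact Kc) {K : Set G} (hK : IsCompact K) {B : Set G} (hB : IsCompact B) :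
    ∃ CN : Set G, IsCompact CN ∧ ∀ c ∈ Kc, ∀ k ∈ K, ∀ n : G, k * (a c * n * b c) * k⁻¹ ∈ B → n ∈ CN := by
  refine ⟨(fun q : P × G × G => (a q.1)⁻¹ * (q.2.1⁻¹ * q.2.2 * q.2.1) * (b q.1)⁻¹) '' (Kc ×ˢ (K ×ˢ B)),
    (hKc.prod (hK.prod hB)).image ?_, fun c hc k hk n hn => ?_⟩
  · exact ((ha.comp continuous_fst).inv.mul (((continuous_fst.comp continuous_snd).inv.mul (continuous_snd.comp continuous_snd)).mul
      (continuous_fst.comp continuous_snd))).mul (hb.comp continuous_fst).inv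
  · refine ⟨(c, k, k * (a c * n * b c) * k⁻¹), ⟨hc, hk, hn⟩, ?_⟩
    dsimp only
    group

end Generic

/-! ## §2 The `K × N` reading at a split place of `U(J₃)(ℂ)` -/

section Split

variable {J : Matrix (Fin 3) (Fin 3) ℂ}

/-- **The boost torus family is continuous**: a family `τ : ℝ³ → U(J)(ℂ)` with `↑↑(τ c) = diag(boostEig c)` and `τ(c + c′) = τ c · τ c′` (★ `exists_torusU_boostEig_family`) is
continuous — the matrix and its inverse `↑↑(τ(−c))` depend continuously on `c` (★ `continuous_boostEig_apply`). [cite: Rogawski1990, §4.9 p. 55] -/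
theorem continuous_torusFamily_of_coe_eq_diagonal_boostEig (τ : (Fin 3 → ℝ) → ↥(unitaryGroupOfForm (starRingEnd ℂ) J))
    (hτcoe : ∀ c, (((τ c : ↥(unitaryGroupOfForm (starRingEnd ℂ) J)) : GL (Fin 3) ℂ) : Matrix (Fin 3) (Fin 3) ℂ) = Matrix.diagonal (boostEig c))
    (hτmul : ∀ c c', τ (c + c') = τ c * τ c') : Continuous τ := by
  have hdiag : Continuous fun c : Fin 3 → ℝ => Matrix.diagonal (boostEig c) :=
    (LinearMap.toContinuousLinearMap (Matrix.diagonalLinearMap (Fin 3) ℂ ℂ)).continuous.comp (continuous_pi fun j => continuous_boostEig_apply j)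
  have h0 : τ 0 = 1 := by
    have h := hτmul 0 0
    rw [add_zero] at h
    exact mul_left_cancel (h.symm.trans (mul_one (τ 0)).symm)
  have hinv : ∀ c, (τ c)⁻¹ = τ (-c) := fun c => by
    have h := hτmul c (-c)
    rw [add_neg_cancel, h0] at h
    exact (eq_inv_of_mul_eq_one_right h.symm).symm
  refine continuous_induced_rng.2 (Units.continuous_iff.2 ⟨?_, ?_⟩)
  · show Continuous fun c => (((τ c : ↥(unitaryGroupOfForm (starRingEnd ℂ) J)) : GL (Fin 3) ℂ) : Matrix (Fin 3) (Fin 3) ℂ)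
    have h : (fun c => (((τ c : ↥(unitaryGroupOfForm (starRingEnd ℂ) J)) : GL (Fin 3) ℂ) : Matrix (Fin 3) (Fin 3) ℂ)) = fun c => Matrix.diagonal (boostEig c) :=
      funext hτcoe
    rw [h]; exact hdiag
  · show Continuous fun c => ((((τ c : ↥(unitaryGroupOfForm (starRingEnd ℂ) J)) : GL (Fin 3) ℂ)⁻¹ : GL (Fin 3) ℂ) : Matrix (Fin 3) (Fin 3) ℂ)
    have h : (fun c => ((((τ c : ↥(unitaryGroupOfForm (starRingEnd ℂ) J)) : GL (Fin 3) ℂ)⁻¹ : GL (Fin 3) ℂ) : Matrix (Fin 3) (Fin 3) ℂ)) =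
        fun c => Matrix.diagonal (boostEig (-c)) := by
      funext c
      rw [← Subgroup.coe_inv, hinv c, hτcoe]
    rw [h]; exact hdiag.comp continuous_neg

/-- **THE UNIPOTENT VARIABLE OF THE `K × N` READING RANGES IN ONE COMPACT**: `K ⊆ U(J₃)(ℂ)` compact, `B ⊆ U(J₃)(ℂ)` compact, `K_c ⊆ ℝ³` compact, `τ` the boost torus family
(`hτcoe`, `hτmul`).  There is ONE compact `C_N ⊆ N` (`N = unipotentU`, closed) with: `k · (τ(0,c′₁,c′₂) τ(c′₀∕2,0,0) · n · τ(c′₀∕2,0,0)) · k⁻¹ ∈ B`, `c′ ∈ K_c`, `k ∈ K` ⇒ `n ∈ C_N` —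
the uniform-compact-support input of Hörmander's theorem for the split-place variables of ★ (A5a)'s unfolded model. [cite: Rogawski1990, §4.9 pp. 54–55; §8.2 p. 114]
[cite: HarishChandra1970, Part I §3 Lemma 22] [cite: DeitmarEchterhoff2014, Lemma 9.3.3] -/
theorem exists_isCompact_unipotentU_of_conj_reading_mem (τ : (Fin 3 → ℝ) → ↥(unitaryGroupOfForm (starRingEnd ℂ) J))
    (hτcoe : ∀ c, (((τ c : ↥(unitaryGroupOfForm (starRingEnd ℂ) J)) : GL (Fin 3) ℂ) : Matrix (Fin 3) (Fin 3) ℂ) = Matrix.diagonal (boostEig c))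
    (hτmul : ∀ c c', τ (c + c') = τ c * τ c')
    {K : Set ↥(unitaryGroupOfForm (starRingEnd ℂ) J)} (hK : IsCompact K) {B : Set ↥(unitaryGroupOfForm (starRingEnd ℂ) J)} (hB : IsCompact B)
    {Kc : Set (Fin 3 → ℝ)} (hKc : IsCompact Kc) :
    ∃ CN : Set ↥(unipotentU (starRingEnd ℂ) J), IsCompact CN ∧
      ∀ c ∈ Kc, ∀ k ∈ K, ∀ n : ↥(unipotentU (starRingEnd ℂ) J),
        k * (τ ![0, c 1, c 2] * τ ![c 0 / 2, 0, 0] * (n : ↥(unitaryGroupOfForm (starRingEnd ℂ) J)) * τ ![c 0 / 2, 0, 0]) * k⁻¹ ∈ B → n ∈ CN := by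
  have hτc := continuous_torusFamily_of_coe_eq_diagonal_boostEig τ hτcoe hτmul
  have h1 : Continuous fun c : Fin 3 → ℝ => (![0, c 1, c 2] : Fin 3 → ℝ) := by
    refine continuous_pi fun i => ?_
    fin_cases i
    · exact continuous_const
    · exact continuous_apply 1
    · exact continuous_apply 2
  have h2 : Continuous fun c : Fin 3 → ℝ => (![c 0 / 2, 0, 0] : Fin 3 → ℝ) := by
    refine continuous_pi fun i => ?_
    fin_cases i
    · exact (continuous_apply 0).div_const _
    · exact continuous_const
    · exact continuous_const
  obtain ⟨CN, hCN, hmem⟩ := exists_isCompact_of_conj_mul_mem (P := Fin 3 → ℝ) (a := fun c => τ ![0, c 1, c 2] * τ ![c 0 / 2, 0, 0]) (b := fun c => τ ![c 0 / 2, 0, 0])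
    ((hτc.comp h1).mul (hτc.comp h2)) (hτc.comp h2) hKc hK hB
  have hNc : IsClosed (unipotentU (starRingEnd ℂ) J : Set ↥(unitaryGroupOfForm (starRingEnd ℂ) J)) := LineRing.isClosed_unipotentU _ _
  refine ⟨((↑) : ↥(unipotentU (starRingEnd ℂ) J) → ↥(unitaryGroupOfForm (starRingEnd ℂ) J)) ⁻¹' CN, hNc.isClosedEmbedding_subtypeVal.isCompact_preimage hCN,
    fun c hc k hk n hn => ?_⟩
  exact hmem c hc k hk _ (by simpa only [mul_assoc] using hn)

end Split

end Literature.NumberTheory.Automorphic.UnitaryGroup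

namespace Literature.NumberTheory.Rogawski1990

open Literature.NumberTheory.Automorphic Literature.NumberTheory.Automorphic.UnitaryGroup

/-! ## §3 The `w₀`-projection of `tsupport a′` -/

section Proj

variable (L : Type) [Field L] [NumberField L] [IsCMField L] (N : ℕ) (H : Matrix (Fin N) (Fin N) L) (w₀ : {w : InfinitePlace L // IsComplex w})

/-- **THE `w₀`-PROJECTION OF THE SUPPORT**: for `a′` on `G′_∞` with compact support, `C_g := {(e g)_{w₀} ∣ g ∈ tsupport a′}` (`e = archPiEquivCM`) is compact, `a′ g = 0` whenever
`(e g)_{w₀} ∉ C_g`, and `a′(e⁻¹(update x w₀ u)) = 0` whenever `u ∉ C_g` — the uniform compact `G_{w₀}`-support of every partial unfolded model of ★ (A5a).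
[cite: Rogawski1990, §4.3 p. 43; §8.2 p. 114] [cite: DeitmarEchterhoff2014, Lemma 9.3.3] -/
theorem exists_isCompact_proj_tsupport {E : Type*} [Zero E] [TopologicalSpace E]
    (a' : ↥(arch (↥(maximalRealSubfield L)) L (IsCMField.complexConj L) N H) → E) (ha's : HasCompactSupport a') :
    ∃ Cg : Set ↥(archLocal L N H w₀), IsCompact Cg ∧
      (∀ g, archPiEquivCM N L H g w₀ ∉ Cg → a' g = 0) ∧
      ∀ [DecidableEq {w : InfinitePlace L // IsComplex w}] (x : ∀ w : {w : InfinitePlace L // IsComplex w}, ↥(archLocal L N H w)) (u : ↥(archLocal L N H w₀)),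
        u ∉ Cg → a' ((archPiEquivCM N L H).symm (Function.update x w₀ u)) = 0 := by
  refine ⟨(fun g => archPiEquivCM N L H g w₀) '' tsupport a', ha's.isCompact.image ((continuous_apply w₀).comp (archPiEquivCM N L H).continuous),
    fun g hg => ?_, fun x u hu => ?_⟩
  · exact image_eq_zero_of_notMem_tsupport fun h => hg ⟨g, h, rfl⟩
  · refine image_eq_zero_of_notMem_tsupport fun h => hu ⟨_, h, ?_⟩
    show archPiEquivCM N L H ((archPiEquivCM N L H).symm (Function.update x w₀ u)) w₀ = u
    rw [ContinuousMulEquiv.apply_symm_apply, Function.update_self]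

end Proj

end Literature.NumberTheory.Rogawski1990

end
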